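import Literature.NumberTheory.LFunctions.ExceptionalCharacterFirstMomentProgressions
import Literature.NumberTheory.LFunctions.ExceptionalCharacterTitchmarshDivisorProblem
import Literature.NumberTheory.LFunctions.RealCharacterLadderLeaves
import Literature.NumberTheory.LFunctions.RealZeroEffectiveRepulsionExplicitII
import HarnessLib
import Summits.Parity.GeneralizedHardyLittlewood.Theorems.UnboundedSiegelZeros

/-!
# No `x`-exceptional character on the certified range: the wide criterion `NoRealZeroUpTo Q`
# switches the «illusory» branches off for `x ≤ e^{(log Q)²}` (PROVED only; debt 0)

Topic `Literature/NumberTheory/LFunctions`. PROOF-OF-DATA consumer for the cell `parity-realchar`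
(SIEGEL INSTRUMENT): the dictionary link between the column's WIDE criterion
`NoRealZeroUpTo Q` (no real zero in `(0,1)` of any primitive quadratic `L(s,χ)`, `3 ≤ q ≤ Q` —
booked two-lineage at `Q = 10¹⁰`, and at `3·10¹⁰` when routes F ∧ G book) and PAGE'S
`x`-EXCEPTIONAL CHARACTER `DrappeauFiorilli2021.IsExceptionalAt b x q χ β` (`q ≤ e^{√log x}`, `χ`
primitive real, `β > 1 − b/(2√log x)` a real zero), the hypothesis under which the «illusory»
secondary terms of Drappeau–Fiorilli 2021 (first moment of primes in progressions, topic I.11) and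
Drappeau 2017 (Titchmarsh divisor problem) appear.

Main lemma (`NoRealZeroUpTo.not_isExceptionalAt`, with `DrappeauFiorilli2021.IsExceptionalAt.basic`:
`½ < β < 1`, `χ ≠ 1`, `3 ≤ q` for an exceptional triple once `x ≥ e^{b²}`): if `NoRealZeroUpTo Q`, then for every `b > 0` and
every `x` with `e^{b²} ≤ x` and `e^{√log x} ≤ Q` — i.e. `b² ≤ log x ≤ (log Q)²` — there is NO
`x`-exceptional triple at level `b`. (The lower constraint only serves to put the threshold
`1 − b/(2√log x)` above `½`, so that a real zero beyond it lies in `(0,1)`; for Page's absolute `b`,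
small in every explicit version, `e^{b²} < 2`.) Reading at `Q = 10¹⁰`: `(log 10¹⁰)² ≈ 530.2`, so the
exceptional branch is void for all `x ≤ e^{530}` (`≈ 10^{230}`) once `x ≥ e^{b²}`.

Consumer (`DrappeauFiorilli2021.bias_of_noRealZeroUpTo`): modulo the named fact
`drappeauFiorilli2021_theorem13`, on that window Fiorilli's UNCONDITIONAL first-moment bias formula
(1.9) `M₁(x,N;a)/((φ(|a|)/|a|)x/N) = μ(a,N) + O_{a,ε}(N^{−171/448+ε})` holds — the bias is NOT
annihilated there. Leaf instances `_leaf_1e10` (booked) and `_leaf_3e10` (value-free until route G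
books). The Titchmarsh-divisor twin (appended 2026-08-27): modulo `drappeau2017_theorem12`
(Drappeau 2017, Theorem 1.2), on the same window `T(x) = ∑_{1<n≤x} Λ(n)τ(n−1)` equals the Fouvry–BFI
main term `C₁x{log x + 2γ − 1 − 2C₂}` up to `O(x e^{−δ√log x})` with NO Siegel secondary term
(`Drappeau2017.T_asymp_of_noRealZeroUpTo`, leaf instances `_leaf_1e10` / `_leaf_3e10`), and likewise
for `∑_{p≤x} τ(p−1)` modulo `drappeau2017_corollary13` (`primeDivisorSum_asymp_of_noRealZeroUpTo`).
Appended (ii): the dictionary's converse direction `DrappeauFiorilli2021.IsExceptionalAt.isSiegelZero` — an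
`x`-exceptional triple at level `b ≤ 1/5` (with `x ≥ e^{b²}`) is a Tao–Teräväinen Siegel zero of quality
`1/((1−β) log q) > 2/b`; together with the tree's `isExceptionalAt_of_isSiegelZero` this makes «Page's
`x`-exceptional character» and «Siegel zero of quality `> 2/b` in the window `log²q ≤ log x`» the same
hypothesis. Appended (iii): `unboundedSiegelZeros_iff_exists_isExceptionalAt` —
`UnboundedSiegelZeros ↔ ∀ b > 0, ∀ X, ∃ x ≥ X` with an `x`-exceptional triple at level `b` (forward via
`isExceptionalAt_of_isSiegelZero`, converse via `IsExceptionalAt.isSiegelZero` and the kernel conductor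
floor `q ≥ η/3`). Appended (iv): `not_exists_isExceptionalAt_of_noSiegelZeros` — the tree's open
`NoSiegelZeros` (constant `c`) switches the exceptional character off at every level `b ≤ min(2c, 1/5)` for
ALL `x ≥ e^{b²}`.

LABEL: proof-of-data consumer / kernel glue; instrument currency above the kernel floor; no Parity
credit (H5). WHAT THIS IS NOT: nothing here asserts `NoRealZeroUpTo Q` for any `Q` beyond the tree's
kernel certificates; the leaves are hypotheses.

## References

* [DrappeauFiorilli2021] S. Drappeau, D. Fiorilli, Trans. London Math. Soc. 8 (2021) 174–185,
  Theorem 1.2 (Page) and the definition after it; Theorem 1.3 (1.9).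
* [Drappeau2017] S. Drappeau, Proc. London Math. Soc. (3) 114 (2017) 684–732, Theorem 1.2 and
  Corollary 1.3 (the Titchmarsh divisor problem with the `x`-exceptional term).
* [Platt2016GRH] D. J. Platt, Math. Comp. 85 (2016), Theorems 7.1–7.2 (the shape of `NoRealZeroUpTo`).
-/

noncomputable section

open Real
open Literature.Barriers.Parity

namespace Literature.NumberTheory.LFunctions

open DrappeauFiorilli2021

/-- A Dirichlet character of modulus `q ≤ 2` is principal; so `χ ≠ 1` forces `3 ≤ q`. [folklore] -/
private theorem three_le_of_ne_one {q : ℕ} [NeZero q] {χ : DirichletCharacter ℂ q} (hχ : χ ≠ 1) :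
    3 ≤ q := by
  by_contra h
  rw [not_le] at h
  have hq0 : q ≠ 0 := NeZero.ne q
  interval_cases q
  · exact hq0 rfl
  · exact hχ (DirichletCharacter.level_one χ)
  · apply hχ
    apply MulChar.ext
    intro a
    have ha : a = 1 := by
      have : Subsingleton (ZMod 2)ˣ := by
        refine Fintype.card_le_one_iff_subsingleton.mp ?_
        rw [ZMod.card_units_eq_totient]
        decide
      exact Subsingleton.elim _ _
    rw [ha]; simp

namespace DrappeauFiorilli2021

/-- **An `x`-exceptional triple at level `b` has `½ < β < 1`, `χ ≠ 1` and `3 ≤ q`, once `x ≥ e^{b²}`**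
(then `√log x ≥ b`, so the threshold `1 − b/(2√log x)` is at least `½`; `β < 1` and `χ ≠ 1` because
no `L(s,χ)` vanishes on `Re s ≥ 1` and `ζ` has no zero in `(0,1)`).
[cite: DrappeauFiorilli2021, §1 Theorem 1.2 and the definition after it] -/
theorem IsExceptionalAt.basic {b x : ℝ} (hb : 0 < b) (hx : Real.exp (b ^ 2) ≤ x) {q : ℕ} [NeZero q]
    {χ : DirichletCharacter ℂ q} {β : ℝ} (h : IsExceptionalAt b x q χ β) :
    1 / 2 < β ∧ β < 1 ∧ χ ≠ 1 ∧ 3 ≤ q := by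
  obtain ⟨_, hprim, _, hβ, hzero⟩ := h
  have hx0 : 0 < x := lt_of_lt_of_le (Real.exp_pos _) hx
  have hlogx : b ^ 2 ≤ Real.log x := by
    rw [← Real.log_exp (b ^ 2)]; exact Real.log_le_log (Real.exp_pos _) hx
  have hS : b ≤ Real.sqrt (Real.log x) := by
    rw [← Real.sqrt_sq hb.le]; exact Real.sqrt_le_sqrt hlogx
  have hSpos : 0 < Real.sqrt (Real.log x) := lt_of_lt_of_le hb hS
  have hfrac : b / (2 * Real.sqrt (Real.log x)) ≤ 1 / 2 := by
    rw [div_le_iff₀ (by positivity)]; linarith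
  have hβhalf : 1 / 2 < β := by linarith
  have hβ0 : 0 < β := by linarith
  -- `β < 1`
  have hβ1 : β < 1 := by
    by_contra hge
    rw [not_lt] at hge
    by_cases hχ : χ = 1
    · subst hχ
      have hq1 : q = 1 := by
        have hcond : (1 : DirichletCharacter ℂ q).conductor = q :=
          (DirichletCharacter.isPrimitive_def _).mp hprim
        rw [DirichletCharacter.conductor_one] at hcond
        exact hcond.symm
      subst hq1
      rw [DirichletCharacter.LFunction_modOne_eq] at hzero
      exact riemannZeta_ne_zero_of_one_le_re (s := (β : ℂ)) (by simpa using hge) hzero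
    · exact DirichletCharacter.LFunction_ne_zero_of_one_le_re χ (Or.inl hχ) (by simpa using hge) hzero
  -- `χ ≠ 1`
  have hne : χ ≠ 1 := by
    intro hχ
    subst hχ
    have hq1 : q = 1 := by
      have hcond : (1 : DirichletCharacter ℂ q).conductor = q :=
        (DirichletCharacter.isPrimitive_def _).mp hprim
      rw [DirichletCharacter.conductor_one] at hcond
      exact hcond.symm
    subst hq1
    rw [DirichletCharacter.LFunction_modOne_eq] at hzero
    exact riemannZeta_ofReal_ne_zero_of_pos_of_lt_one β hβ0 hβ1 hzero
  exact ⟨hβhalf, hβ1, hne, three_le_of_ne_one hne⟩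

end DrappeauFiorilli2021

/-- **The wide criterion switches the exceptional character off.** If `NoRealZeroUpTo Q`, `b > 0`,
`e^{b²} ≤ x` and `e^{√log x} ≤ Q`, then no triple `(q, χ, β)` is `x`-exceptional at level `b`: such a
triple would have `3 ≤ q ≤ e^{√log x} ≤ Q`, `χ` primitive quadratic and a real zero `β ∈ (½, 1)`,
excluded by the criterion. [cite: DrappeauFiorilli2021, §1 Theorem 1.2 and the definition after it]
[cite: Platt2016GRH, Theorems 7.1 and 7.2] -/
theorem NoRealZeroUpTo.not_isExceptionalAt {Q : ℕ} (hW : NoRealZeroUpTo Q) {b x : ℝ} (hb : 0 < b)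
    (hx : Real.exp (b ^ 2) ≤ x) (hxQ : Real.exp (Real.sqrt (Real.log x)) ≤ Q) {q : ℕ} [NeZero q]
    (χ : DirichletCharacter ℂ q) (β : ℝ) : ¬ IsExceptionalAt b x q χ β := by
  intro h
  obtain ⟨hβhalf, hβ1, _, hq3⟩ := h.basic hb hx
  obtain ⟨hqx, hprim, hquad, _, hzero⟩ := h
  have hqQ : q ≤ Q := by exact_mod_cast hqx.trans hxQ
  exact hW q hq3 hqQ χ hquad hprim β (by linarith) hβ1 hzero

/-- The `¬∃` form consumed by the named facts' "no `x`-exceptional character" clauses.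
[cite: DrappeauFiorilli2021, §1 Theorem 1.3 (1.9)] -/
theorem NoRealZeroUpTo.not_exists_isExceptionalAt {Q : ℕ} (hW : NoRealZeroUpTo Q) {b x : ℝ}
    (hb : 0 < b) (hx : Real.exp (b ^ 2) ≤ x) (hxQ : Real.exp (Real.sqrt (Real.log x)) ≤ Q) :
    ¬ ∃ (q : ℕ) (_ : NeZero q) (χ : DirichletCharacter ℂ q) (β : ℝ), IsExceptionalAt b x q χ β := by
  rintro ⟨q, hq, χ, β, h⟩
  exact hW.not_isExceptionalAt hb hx hxQ χ β h

namespace DrappeauFiorilli2021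

/-- **The window in closed form**: for `x ≥ 1` and `Q ≥ 1`, `e^{√log x} ≤ Q ↔ log x ≤ (log Q)²`
(the range `q̃ ≤ e^{√log x}` of Page's theorem at `Q = T = e^{√log x}` meets the table iff
`log x ≤ (log Q)²`). [cite: DrappeauFiorilli2021, §1 Theorem 1.2 and the definition after it] -/
theorem IsExceptionalAt.exp_sqrt_log_le_iff {x : ℝ} (hx : 1 ≤ x) {Q : ℝ} (hQ : 1 ≤ Q) :
    Real.exp (Real.sqrt (Real.log x)) ≤ Q ↔ Real.log x ≤ Real.log Q ^ 2 := by
  have hlogQ : 0 ≤ Real.log Q := Real.log_nonneg hQ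
  have hlogx : 0 ≤ Real.log x := Real.log_nonneg hx
  rw [← Real.le_log_iff_exp_le (by linarith)]
  constructor
  · intro h
    calc Real.log x = Real.sqrt (Real.log x) ^ 2 := (Real.sq_sqrt hlogx).symm
      _ ≤ Real.log Q ^ 2 := pow_le_pow_left₀ (Real.sqrt_nonneg _) h 2
  · intro h
    calc Real.sqrt (Real.log x) ≤ Real.sqrt (Real.log Q ^ 2) := Real.sqrt_le_sqrt h
      _ = Real.log Q := Real.sqrt_sq hlogQ

/-- **Fiorilli's bias is not annihilated on the certified range** (consumer of the wide criterion,
modulo the named fact `drappeauFiorilli2021_theorem13`): if `NoRealZeroUpTo Q`, then with the fact's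
absolute `b, δ`, for every `a ≠ 0`, `ε > 0` there is `K` with
`|M₁(x,N;a)/((φ(|a|)/|a|)x/N) − μ(a,N)| ≤ K N^{−171/448+ε}` for all `x ≥ max(2, e^{b²})` with
`e^{√log x} ≤ Q` and all `2 ≤ N ≤ e^{δ√log x}` — clause (1.9), the exceptional clauses (1.10)/(1.11)
being void there. [cite: DrappeauFiorilli2021, §1 Theorem 1.3 (1.9)]
[cite: Platt2016GRH, Theorems 7.1 and 7.2] -/
theorem bias_of_noRealZeroUpTo (h13 : drappeauFiorilli2021_theorem13) {Q : ℕ}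
    (hW : NoRealZeroUpTo Q) :
    ∃ b : ℝ, 0 < b ∧ ∃ δ : ℝ, 0 < δ ∧ ∀ a : ℤ, a ≠ 0 → ∀ ε : ℝ, 0 < ε → ∃ K : ℝ,
      ∀ x N : ℝ, 2 ≤ x → Real.exp (b ^ 2) ≤ x → Real.exp (Real.sqrt (Real.log x)) ≤ Q →
        2 ≤ N → N ≤ Real.exp (δ * Real.sqrt (Real.log x)) →
          |M1 x N a / normaliser x N a - mu a N| ≤ K * N ^ (-(171 / 448 : ℝ) + ε) := by
  obtain ⟨b, hb, δ, hδ, H⟩ := h13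
  refine ⟨b, hb, δ, hδ, fun a ha ε hε => ?_⟩
  obtain ⟨K, hK⟩ := H a ha ε hε
  refine ⟨K, fun x N hx hxb hxQ hN hNx => ?_⟩
  exact (hK x N hx hN hNx).1 (hW.not_exists_isExceptionalAt hb hxb hxQ)

/-- Leaf instance at `Q = 10¹⁰` (booked two-lineage decade; window `log x ≤ (log 10¹⁰)² ≈ 530`).
[cite: DrappeauFiorilli2021, §1 Theorem 1.3 (1.9)] -/
theorem bias_of_leaf_1e10 (h13 : drappeauFiorilli2021_theorem13) (hW : NoRealZeroUpTo_1e10) :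
    ∃ b : ℝ, 0 < b ∧ ∃ δ : ℝ, 0 < δ ∧ ∀ a : ℤ, a ≠ 0 → ∀ ε : ℝ, 0 < ε → ∃ K : ℝ,
      ∀ x N : ℝ, 2 ≤ x → Real.exp (b ^ 2) ≤ x →
        Real.exp (Real.sqrt (Real.log x)) ≤ (10000000000 : ℕ) →
        2 ≤ N → N ≤ Real.exp (δ * Real.sqrt (Real.log x)) →
          |M1 x N a / normaliser x N a - mu a N| ≤ K * N ^ (-(171 / 448 : ℝ) + ε) :=
  bias_of_noRealZeroUpTo h13 hW

/-- Leaf instance at `Q = 3·10¹⁰` (value-free until routes F ∧ G book `NoRealZeroUpTo_3e10`; window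
`log x ≤ (log 3·10¹⁰)² ≈ 582`). [cite: DrappeauFiorilli2021, §1 Theorem 1.3 (1.9)] -/
theorem bias_of_leaf_3e10 (h13 : drappeauFiorilli2021_theorem13) (hW : NoRealZeroUpTo_3e10) :
    ∃ b : ℝ, 0 < b ∧ ∃ δ : ℝ, 0 < δ ∧ ∀ a : ℤ, a ≠ 0 → ∀ ε : ℝ, 0 < ε → ∃ K : ℝ,
      ∀ x N : ℝ, 2 ≤ x → Real.exp (b ^ 2) ≤ x →
        Real.exp (Real.sqrt (Real.log x)) ≤ (30000000000 : ℕ) →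
        2 ≤ N → N ≤ Real.exp (δ * Real.sqrt (Real.log x)) →
          |M1 x N a / normaliser x N a - mu a N| ≤ K * N ^ (-(171 / 448 : ℝ) + ε) :=
  bias_of_noRealZeroUpTo h13 hW

end DrappeauFiorilli2021

/-! ### Appended 2026-08-27: the Titchmarsh-divisor twin (Drappeau 2017, Theorem 1.2 / Corollary 1.3) -/

namespace Drappeau2017

/-- **No Siegel secondary term in the Titchmarsh divisor problem on the certified range** (consumer
of the wide criterion, modulo the named fact `drappeau2017_theorem12`): if `NoRealZeroUpTo Q`, then
with Drappeau's absolute `b, δ` and constant `K`, for every `x ≥ max(2, e^{b²})` with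
`e^{√log x} ≤ Q` (i.e. `log x ≤ (log Q)²`): `|T(x) − C₁x{log x + 2γ − 1 − 2C₂}| ≤ K x e^{−δ√log x}` —
the `x`-exceptional character, hence the term `−C₁(q)(x^β/β){…}`, cannot occur there.
[cite: Drappeau2017, §1.1 Theorem 1.2] [cite: Platt2016GRH, Theorems 7.1 and 7.2] -/
theorem T_asymp_of_noRealZeroUpTo (h12 : drappeau2017_theorem12) {Q : ℕ} (hW : NoRealZeroUpTo Q) :
    ∃ b : ℝ, 0 < b ∧ ∃ δ : ℝ, 0 < δ ∧ ∃ K : ℝ, ∀ x : ℝ, 2 ≤ x → Real.exp (b ^ 2) ≤ x →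
      Real.exp (Real.sqrt (Real.log x)) ≤ Q →
        |T x - mainTerm x| ≤ K * (x * Real.exp (-(δ * Real.sqrt (Real.log x)))) := by
  obtain ⟨b, hb, δ, hδ, K, hK⟩ := h12
  exact ⟨b, hb, δ, hδ, K, fun x hx hxb hxQ =>
    (hK x hx).1 (hW.not_exists_isExceptionalAt hb hxb hxQ)⟩

/-- Leaf instance at `Q = 10¹⁰` (booked decade; window `log x ≤ (log 10¹⁰)² ≈ 530`): no Siegel term
in `T(x)` for `max(2, e^{b²}) ≤ x ≤ e^{(log 10¹⁰)²}`. [cite: Drappeau2017, §1.1 Theorem 1.2] -/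
theorem T_asymp_of_leaf_1e10 (h12 : drappeau2017_theorem12) (hW : NoRealZeroUpTo_1e10) :
    ∃ b : ℝ, 0 < b ∧ ∃ δ : ℝ, 0 < δ ∧ ∃ K : ℝ, ∀ x : ℝ, 2 ≤ x → Real.exp (b ^ 2) ≤ x →
      Real.exp (Real.sqrt (Real.log x)) ≤ (10000000000 : ℕ) →
        |T x - mainTerm x| ≤ K * (x * Real.exp (-(δ * Real.sqrt (Real.log x)))) :=
  T_asymp_of_noRealZeroUpTo h12 hW

/-- Leaf instance at `Q = 3·10¹⁰` (value-free until routes F ∧ G book `NoRealZeroUpTo_3e10`; window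
`log x ≤ (log 3·10¹⁰)² ≈ 582`). [cite: Drappeau2017, §1.1 Theorem 1.2] -/
theorem T_asymp_of_leaf_3e10 (h12 : drappeau2017_theorem12) (hW : NoRealZeroUpTo_3e10) :
    ∃ b : ℝ, 0 < b ∧ ∃ δ : ℝ, 0 < δ ∧ ∃ K : ℝ, ∀ x : ℝ, 2 ≤ x → Real.exp (b ^ 2) ≤ x →
      Real.exp (Real.sqrt (Real.log x)) ≤ (30000000000 : ℕ) →
        |T x - mainTerm x| ≤ K * (x * Real.exp (-(δ * Real.sqrt (Real.log x)))) :=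
  T_asymp_of_noRealZeroUpTo h12 hW

/-- **The same for `∑_{p ≤ x} τ(p − 1)`** (modulo `drappeau2017_corollary13`): on the certified window,
`|∑_{p≤x} τ(p−1) − C₁{x + 2 li(x)(γ − C₂)}| ≤ K x e^{−δ√log x}`, no Siegel term.
[cite: Drappeau2017, §1.1 Corollary 1.3] [cite: Platt2016GRH, Theorems 7.1 and 7.2] -/
theorem primeDivisorSum_asymp_of_noRealZeroUpTo (h13 : drappeau2017_corollary13) {Q : ℕ}
    (hW : NoRealZeroUpTo Q) :
    ∃ b : ℝ, 0 < b ∧ ∃ δ : ℝ, 0 < δ ∧ ∃ K : ℝ, ∀ x : ℝ, 2 ≤ x → Real.exp (b ^ 2) ≤ x →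
      Real.exp (Real.sqrt (Real.log x)) ≤ Q →
        |primeDivisorSum x - mainTermPrimes x| ≤
          K * (x * Real.exp (-(δ * Real.sqrt (Real.log x)))) := by
  obtain ⟨b, hb, δ, hδ, K, hK⟩ := h13
  exact ⟨b, hb, δ, hδ, K, fun x hx hxb hxQ =>
    (hK x hx).1 (hW.not_exists_isExceptionalAt hb hxb hxQ)⟩

end Drappeau2017

/-! ### Appended 2026-08-27 (ii): the dictionary `x`-exceptional character ⟹ Siegel zero of quality `> 2/b` -/

namespace DrappeauFiorilli2021

/-- **An `x`-exceptional character IS a Tao–Teräväinen Siegel zero of quality `> 2/b`** (the converse of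
`isExceptionalAt_of_isSiegelZero`, closing the §1 dictionary between Page's `x`-exceptional character
and `IsSiegelZero`): if `(q, χ, β)` is `x`-exceptional at level `b ≤ 1/5` with `x ≥ e^{b²}`, then
`χ` is primitive quadratic mod `q ≥ 3`, `β < 1`, and with `η := 1/((1 − β) log q)` one has
`IsSiegelZero χ η`, `β = 1 − 1/(η log q)` and `η > 2/b ≥ 10` — because `log q ≤ √log x` and
`1 − β < b/(2√log x)` give `(1 − β) log q < b/2`. [cite: DrappeauFiorilli2021, §1 Theorem 1.2 and the definition after it]
[cite: TaoTeravainen2021, Definition 1.4] -/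
theorem IsExceptionalAt.isSiegelZero {b x : ℝ} (hb : 0 < b) (hb5 : b ≤ 1 / 5)
    (hx : Real.exp (b ^ 2) ≤ x) {q : ℕ} [NeZero q] {χ : DirichletCharacter ℂ q} {β : ℝ}
    (h : IsExceptionalAt b x q χ β) :
    IsSiegelZero χ (1 / ((1 - β) * Real.log q)) ∧ 2 / b < 1 / ((1 - β) * Real.log q) := by
  obtain ⟨_, hβ1, _, hq3⟩ := h.basic hb hx
  obtain ⟨hqx, hprim, hquad, hβ, hzero⟩ := h
  have hq3r : (3 : ℝ) ≤ q := by exact_mod_cast hq3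
  have hq0 : (0 : ℝ) < q := by linarith
  have hlogq : 1 < Real.log (q : ℝ) := by
    have h9 := Real.exp_one_lt_d9
    rw [Real.lt_log_iff_exp_lt hq0]; linarith
  have hlogq0 : 0 < Real.log (q : ℝ) := by linarith
  -- `log q ≤ √log x`
  have hS : Real.log q ≤ Real.sqrt (Real.log x) := (Real.log_le_iff_le_exp hq0).mpr hqx
  have hSpos : 0 < Real.sqrt (Real.log x) := lt_of_lt_of_le hlogq0 hS
  have h1β : 0 < 1 - β := by linarith
  -- `(1 − β) log q < b/2`
  have hkey : (1 - β) * Real.log q < b / 2 := by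
    have h1 : 1 - β < b / (2 * Real.sqrt (Real.log x)) := by linarith
    have h2 : (1 - β) * Real.sqrt (Real.log x) < b / 2 := by
      have := (lt_div_iff₀ (by positivity : (0 : ℝ) < 2 * Real.sqrt (Real.log x))).mp h1
      linarith
    calc (1 - β) * Real.log q ≤ (1 - β) * Real.sqrt (Real.log x) :=
          mul_le_mul_of_nonneg_left hS h1β.le
      _ < b / 2 := h2
  have hpos : 0 < (1 - β) * Real.log q := mul_pos h1β hlogq0
  have hqual : 2 / b < 1 / ((1 - β) * Real.log q) := by
    rw [div_lt_div_iff₀ hb hpos]; linarith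
  have h10 : 10 ≤ 1 / ((1 - β) * Real.log q) := by
    have : (10 : ℝ) ≤ 2 / b := by
      rw [le_div_iff₀ hb]; linarith
    linarith
  refine ⟨⟨hprim, hquad, h10, ?_⟩, hqual⟩
  -- `1 − 1/(η log q) = β` for `η = 1/((1−β) log q)`
  have hβeq : 1 - 1 / (1 / ((1 - β) * Real.log q) * Real.log q) = β := by
    field_simp
    ring
  rw [hβeq]
  exact hzero


/-! ### Appended 2026-08-27 (iii): `UnboundedSiegelZeros` ⟺ `x`-exceptional characters at every level `b`
at arbitrarily large `x` (the §1 dictionary as an equivalence; PROVED, debt 0) -/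

/-- **Forward**: Siegel zeros of unbounded quality at unbounded conductors (`UnboundedSiegelZeros`) give,
for every level `b > 0` and every `X`, an `x ≥ X` (indeed `x = e^{(log q)²}` for a suitable conductor
`q`) carrying an `x`-exceptional triple. [cite: DrappeauFiorilli2021, §1 Theorem 1.2 and the definition after it]
[cite: TaoTeravainen2021, Definition 1.4] -/
theorem exists_isExceptionalAt_of_unboundedSiegelZeros (hU : Summit.Parity.GeneralizedHardyLittlewood.UnboundedSiegelZeros) {b : ℝ} (hb : 0 < b)
    (X : ℝ) : ∃ x : ℝ, X ≤ x ∧ ∃ (q : ℕ) (_ : NeZero q) (χ : DirichletCharacter ℂ q) (β : ℝ),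
      IsExceptionalAt b x q χ β := by
  obtain ⟨q, hq0, χ, η, hq, hη, hS⟩ := hU (4 / b) (max 3 ⌈X⌉₊)
  haveI := hq0
  have hq3 : 3 ≤ q := le_trans (le_max_left _ _) hq
  have hqX : X ≤ q := le_trans (Nat.le_ceil X) (by exact_mod_cast le_trans (le_max_right _ _) hq)
  have hq3r : (3 : ℝ) ≤ q := by exact_mod_cast hq3
  have hq0r : (0 : ℝ) < q := by linarith
  have hlogq : 1 < Real.log (q : ℝ) := by
    have h9 := Real.exp_one_lt_d9
    rw [Real.lt_log_iff_exp_lt hq0r]; linarith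
  set x : ℝ := Real.exp (Real.log q ^ 2) with hxdef
  have hlogx : Real.log x = Real.log q ^ 2 := Real.log_exp _
  have hqlex : (q : ℝ) ≤ x := by
    calc (q : ℝ) = Real.exp (Real.log q) := (Real.exp_log hq0r).symm
      _ ≤ Real.exp (Real.log q ^ 2) := Real.exp_le_exp.mpr (by nlinarith)
  have hw1 : Real.log q ^ 2 ≤ Real.log x := hlogx.symm.le
  have hw2 : Real.log x < (b * η * Real.log q / 2) ^ 2 := by
    rw [hlogx]
    have hbη : 2 ≤ b * η / 2 := by
      have : 4 / b ≤ η := hη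
      rw [div_le_iff₀ hb] at this
      linarith
    have h1 : Real.log q < b * η * Real.log q / 2 := by nlinarith
    exact pow_lt_pow_left₀ h1 (by linarith) two_ne_zero
  exact ⟨x, le_trans hqX hqlex, q, hq0, χ, _, isExceptionalAt_of_isSiegelZero hb hq3 hS hw1 hw2⟩

/-- **Converse**: if for every level `b > 0` there are `x`-exceptional triples at arbitrarily large `x`,
then Siegel zeros of unbounded quality exist at unbounded conductors. (For `b ≤ min(1/5, 2/η₀, 2/(3q₀))`
an exceptional triple at `x ≥ e^{b²}` is a Siegel zero of quality `> 2/b ≥ η₀` by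
`IsExceptionalAt.isSiegelZero`, and its conductor is `≥ quality/3 ≥ q₀` by the kernel's
`RealZeroRepulsion.isSiegelZero_conductor_ge_third`.) [cite: DrappeauFiorilli2021, §1 Theorem 1.2 and the definition after it]
[cite: TaoTeravainen2021, Definition 1.4] -/
theorem unboundedSiegelZeros_of_exists_isExceptionalAt
    (h : ∀ b : ℝ, 0 < b → ∀ X : ℝ, ∃ x : ℝ, X ≤ x ∧
      ∃ (q : ℕ) (_ : NeZero q) (χ : DirichletCharacter ℂ q) (β : ℝ), IsExceptionalAt b x q χ β) :
    Summit.Parity.GeneralizedHardyLittlewood.UnboundedSiegelZeros := by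
  intro η₀ q₀
  -- the level
  set b : ℝ := min (1 / 5) (min (2 / max η₀ 1) (2 / (3 * max (q₀ : ℝ) 1))) with hbdef
  have hη1 : 1 ≤ max η₀ 1 := le_max_right _ _
  have hq1 : (1 : ℝ) ≤ max (q₀ : ℝ) 1 := le_max_right _ _
  have hb : 0 < b := by
    refine lt_min (by norm_num) (lt_min ?_ ?_) <;> positivity
  have hb5 : b ≤ 1 / 5 := min_le_left _ _
  have hbη : b ≤ 2 / max η₀ 1 := le_trans (min_le_right _ _) (min_le_left _ _)
  have hbq : b ≤ 2 / (3 * max (q₀ : ℝ) 1) := le_trans (min_le_right _ _) (min_le_right _ _)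
  obtain ⟨x, hx, q, hq0, χ, β, hE⟩ := h b hb (Real.exp (b ^ 2))
  haveI := hq0
  obtain ⟨hS, hqual⟩ := hE.isSiegelZero hb hb5 hx
  obtain ⟨_, _, _, hq3⟩ := hE.basic hb hx
  set η : ℝ := 1 / ((1 - β) * Real.log q) with hηdef
  refine ⟨q, hq0, χ, η, ?_, ?_, hS⟩
  · -- conductor: `q ≥ η/3 > 2/(3b) ≥ q₀`
    have hcond := RealZeroRepulsion.isSiegelZero_conductor_ge_third hq3 hS
    have h1 : 2 / b ≥ 3 * max (q₀ : ℝ) 1 := by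
      rw [ge_iff_le, le_div_iff₀ hb]
      have := (le_div_iff₀ (by positivity : (0 : ℝ) < 3 * max (q₀ : ℝ) 1)).mp hbq
      linarith
    have h2 : (q₀ : ℝ) ≤ max (q₀ : ℝ) 1 := le_max_left _ _
    have : (q₀ : ℝ) ≤ q := by linarith
    exact_mod_cast this
  · -- quality: `η > 2/b ≥ η₀`
    have h1 : 2 / b ≥ max η₀ 1 := by
      rw [ge_iff_le, le_div_iff₀ hb]
      have := (le_div_iff₀ (by positivity : (0 : ℝ) < max η₀ 1)).mp hbη
      linarith
    have h2 : η₀ ≤ max η₀ 1 := le_max_left _ _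
    linarith

/-- **The §1 dictionary as an equivalence**: `UnboundedSiegelZeros` holds iff for every level `b > 0`
Page's `x`-exceptional character exists at arbitrarily large `x`.
[cite: DrappeauFiorilli2021, §1 Theorem 1.2 and the definition after it] [cite: TaoTeravainen2021, Definition 1.4] -/
theorem unboundedSiegelZeros_iff_exists_isExceptionalAt :
    Summit.Parity.GeneralizedHardyLittlewood.UnboundedSiegelZeros ↔ ∀ b : ℝ, 0 < b → ∀ X : ℝ, ∃ x : ℝ, X ≤ x ∧
      ∃ (q : ℕ) (_ : NeZero q) (χ : DirichletCharacter ℂ q) (β : ℝ), IsExceptionalAt b x q χ β :=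
  ⟨fun hU _ hb X => exists_isExceptionalAt_of_unboundedSiegelZeros hU hb X,
    unboundedSiegelZeros_of_exists_isExceptionalAt⟩


/-! ### Appended 2026-08-27 (iv): the open hypothesis `NoSiegelZeros` switches every small level off -/

/-- **`NoSiegelZeros` ⇒ no `x`-exceptional character at any small level, for all `x ≥ e^{b²}`.** If for
some `c > 0` no `L(σ, χ)` (`χ` real primitive mod `q ≥ 3`) vanishes for `σ > 1 − c/log q` (the tree's
open statement `NoSiegelZeros`), then for every level `0 < b ≤ min(2c, 1/5)` and every `x ≥ e^{b²}` there
is no `x`-exceptional triple: such a triple is a Siegel zero with `(1 − β) log q < b/2 ≤ c`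
(`IsExceptionalAt.isSiegelZero`). Contrast: `NoRealZeroUpTo Q` switches the exceptional character off
on the WINDOW `log x ≤ (log Q)²` for EVERY level; `NoSiegelZeros` switches it off for ALL `x`, at small
levels. [cite: DrappeauFiorilli2021, §1 Theorem 1.2 and the definition after it] -/
theorem not_exists_isExceptionalAt_of_noSiegelZeros (hN : NoSiegelZeros) :
    ∃ b₀ : ℝ, 0 < b₀ ∧ ∀ b : ℝ, 0 < b → b ≤ b₀ → ∀ x : ℝ, Real.exp (b ^ 2) ≤ x →
      ¬ ∃ (q : ℕ) (_ : NeZero q) (χ : DirichletCharacter ℂ q) (β : ℝ), IsExceptionalAt b x q χ β := by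
  obtain ⟨c, hc, hzero⟩ := hN
  refine ⟨min (2 * c) (1 / 5), lt_min (by linarith) (by norm_num), fun b hb hb₀ x hx => ?_⟩
  rintro ⟨q, hq, χ, β, hE⟩
  have hb5 : b ≤ 1 / 5 := le_trans hb₀ (min_le_right _ _)
  have hbc : b ≤ 2 * c := le_trans hb₀ (min_le_left _ _)
  obtain ⟨hS, hqual⟩ := hE.isSiegelZero hb hb5 hx
  obtain ⟨_, hβ1, _, hq3⟩ := hE.basic hb hx
  obtain ⟨hprim, hquad, _, hLzero⟩ := hS
  have hq3r : (3 : ℝ) ≤ q := by exact_mod_cast hq3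
  have hlogq : 0 < Real.log (q : ℝ) := Real.log_pos (by linarith)
  have h1β : 0 < 1 - β := by linarith
  -- quality `1/((1−β) log q) > 2/b ≥ 1/c`, i.e. `(1 − β) log q < c`, i.e. `β > 1 − c/log q`
  have hpos : 0 < (1 - β) * Real.log q := mul_pos h1β hlogq
  have hlt : (1 - β) * Real.log q < c := by
    have h2 : 2 / b < 1 / ((1 - β) * Real.log q) := hqual
    rw [div_lt_div_iff₀ hb hpos] at h2
    nlinarith
  have hσ : 1 - c / Real.log q < β := by
    rw [div_eq_mul_inv]
    have : (1 - β) < c / Real.log q := by rw [lt_div_iff₀ hlogq]; exact hlt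
    rw [div_eq_mul_inv] at this
    linarith
  -- the zero `β = 1 − 1/(η log q)` of `IsSiegelZero` is `β` itself
  have hβeq : (1 - 1 / (1 / ((1 - β) * Real.log q) * Real.log q) : ℝ) = β := by
    field_simp
    ring
  rw [hβeq] at hLzero
  exact hzero q hq3 χ hquad hprim β hσ hLzero

end DrappeauFiorilli2021

end Literature.NumberTheory.LFunctions

end
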